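import Literature.Analysis.Complex.AnalyticFormalRoots
import HarnessLib

/-!
# Local holomorphic root systems from a formal factorization

Topic `Literature/Analysis/Complex` (namespace `Literature.Analysis.Complex.FormalRoot`), sequel
of `AnalyticFormalRoots.lean`. Everything here is PROVED (no definitions, no named facts).

Let `b₀, …, b_d` be holomorphic on a disc `|z| < ρ` and suppose that the polynomial
`Σₙ 𝓣[bₙ] Yⁿ ∈ ℂ⟦z⟧[Y]` (Taylor series at `0` as coefficients) FACTORS FORMALLY as
`𝓣[b_d] · ∏ᵢ (Y − rᵢ)` with pairwise distinct `rᵢ ∈ ℂ⟦z⟧` (`i` in a finite index type of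
cardinality `d`) and `b_d(0) ≠ 0`. Then (`exists_local_roots_of_taylor_factorization`) the `rᵢ`
are the Taylor series of holomorphic functions `yᵢ` on some `|z| < ε` and
`Σₙ bₙ(z) Yⁿ = b_d(z) ∏ᵢ (Y − yᵢ(z))` for all `|z| < ε`: the formal roots are simple, hence jets
of holomorphic roots (`exists_holomorphic_root_of_formal_root`), pairwise distinct as germs, so
the factorization holds on a punctured neighbourhood (a polynomial of degree `d` with `d`
distinct roots) and at `0` by continuity. This is the analytic-coefficient version of
`Literature.NumberTheory.Automorphic.ModularLambda.exists_local_roots_of_formal_factorization`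
(polynomial coefficients), needed at a cusp, where the coefficients are cusp functions.

Written for the analytic proof that Galois conjugates of (noncongruence) modular forms are
modular forms (Calegari–Dimitrov–Tang, *The unbounded denominators conjecture*, Remark 59).
[folklore]
-/

noncomputable section

open Complex Filter Topology Set Metric Finset PowerSeries
open scoped Nat Polynomial

namespace Literature.Analysis.Complex

namespace FormalRoot

open Literature.NumberTheory.Transcendental.AndreCriterion (coeff_taylor constantCoeff_taylor
  taylor_congr taylor_add taylor_sum taylor_const_mul taylor_mul taylor_one taylor_pow)

/-- The Taylor series of `f : ℂ → ℂ` at `0`, as a formal power series (local notation, as in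
`AndreCriterionAnalyticProofs`). -/
local notation3 "𝓣[" f "]" =>
  (PowerSeries.mk fun n => ((Nat.factorial n : ℂ)⁻¹ * iteratedDeriv n f 0) : PowerSeries ℂ)

/-- Coefficient recursion for `(X − C c) p`. [folklore] -/
private theorem coeff_X_sub_C_mul (c : ℂ) (p : ℂ[X]) (n : ℕ) :
    ((Polynomial.X - Polynomial.C c) * p).coeff n =
      (if n = 0 then 0 else p.coeff (n - 1)) - c * p.coeff n := by
  rw [sub_mul, Polynomial.coeff_sub, Polynomial.coeff_C_mul]
  rcases n with _ | n
  · rw [Polynomial.coeff_X_mul_zero, if_pos rfl]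
  · rw [Polynomial.coeff_X_mul, if_neg (Nat.succ_ne_zero n), Nat.succ_sub_one]

/-- Differentiability of the coefficients of `C c(t) · ∏ (X − C gᵢ(t))`. [folklore] -/
private theorem differentiableOn_coeff_C_mul_prod {ι : Type*} {U : Set ℂ} {c : ℂ → ℂ}
    (hc : DifferentiableOn ℂ c U) {g : ι → ℂ → ℂ} (s : Finset ι)
    (hg : ∀ i ∈ s, DifferentiableOn ℂ (g i) U) (n : ℕ) :
    DifferentiableOn ℂ (fun t ↦ (Polynomial.C (c t) *
      ∏ i ∈ s, (Polynomial.X - Polynomial.C (g i t))).coeff n) U := by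
  classical
  induction s using Finset.induction_on generalizing n with
  | empty =>
    simp only [Finset.prod_empty, mul_one, Polynomial.coeff_C]
    split_ifs
    · exact hc
    · exact differentiableOn_const _
  | insert a s ha ih =>
    have hgs : ∀ i ∈ s, DifferentiableOn ℂ (g i) U := fun i hi ↦ hg i (Finset.mem_insert_of_mem hi)
    simp only [Finset.prod_insert ha]
    have hfun : (fun t ↦ (Polynomial.C (c t) * ((Polynomial.X - Polynomial.C (g a t)) *
        ∏ i ∈ s, (Polynomial.X - Polynomial.C (g i t)))).coeff n) =
        fun t ↦ (if n = 0 then (0 : ℂ) else (Polynomial.C (c t) *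
          ∏ i ∈ s, (Polynomial.X - Polynomial.C (g i t))).coeff (n - 1)) -
          g a t * (Polynomial.C (c t) * ∏ i ∈ s, (Polynomial.X - Polynomial.C (g i t))).coeff n := by
      funext t
      rw [mul_left_comm, coeff_X_sub_C_mul]
    rw [hfun]
    refine DifferentiableOn.sub ?_ ((hg a (Finset.mem_insert_self a s)).mul (ih hgs n))
    split_ifs
    · exact differentiableOn_const _
    · exact ih hgs (n - 1)

/-- **Local holomorphic roots from a formal factorization (analytic coefficients).** Let
`b₀, …, b_d` be holomorphic on `|z| < ρ` with `b_d(0) ≠ 0`, and suppose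
`𝓣[bₙ] = [Yⁿ] (𝓣[b_d] ∏ᵢ (Y − rᵢ))` for `n ≤ d` with pairwise distinct `rᵢ ∈ ℂ⟦z⟧`, `#ι = d`. Then
there are `ε > 0` and `yᵢ` holomorphic on `|z| < ε` with `𝓣[yᵢ] = rᵢ` and
`Σ_{n ≤ d} bₙ(z) Yⁿ = b_d(z) ∏ᵢ (Y − yᵢ(z))` for all `|z| < ε`. [folklore] -/
theorem exists_local_roots_of_taylor_factorization {ι : Type*} [Fintype ι] [DecidableEq ι]
    [Nonempty ι] {d : ℕ} (hd : Fintype.card ι = d) {b : ℕ → ℂ → ℂ} {ρ : ℝ} (hρ : 0 < ρ)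
    (hb : ∀ n ∈ range (d + 1), DifferentiableOn ℂ (b n) (ball 0 ρ)) (hb0 : b d 0 ≠ 0)
    {r : ι → PowerSeries ℂ} (hr : Function.Injective r)
    (hfact : ∀ n ∈ range (d + 1),
      𝓣[b n] = (Polynomial.C 𝓣[b d] * ∏ i, (Polynomial.X - Polynomial.C (r i))).coeff n) :
    ∃ ε > 0, ε ≤ ρ ∧ ∃ y : ι → ℂ → ℂ, (∀ i, DifferentiableOn ℂ (y i) (ball 0 ε)) ∧
      (∀ i, 𝓣[y i] = r i) ∧
      ∀ z ∈ ball (0 : ℂ) ε, (∑ n ∈ range (d + 1), Polynomial.C (b n z) * Polynomial.X ^ n : ℂ[X]) =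
        Polynomial.C (b d z) * ∏ i, (Polynomial.X - Polynomial.C (y i z)) := by
  classical
  have hdmem : d ∈ range (d + 1) := Finset.mem_range.mpr (Nat.lt_succ_self d)
  -- ### separation order of the distinct formal roots
  have hsep0 : ∀ p : ι × ι, ∃ n : ℕ, p.1 ≠ p.2 →
      PowerSeries.coeff n (r p.1) ≠ PowerSeries.coeff n (r p.2) := by
    rintro ⟨i, j⟩
    by_cases hij : i = j
    · exact ⟨0, fun h ↦ absurd hij h⟩
    · have hne : r i ≠ r j := fun h ↦ hij (hr h)
      obtain ⟨n, hn⟩ : ∃ n, PowerSeries.coeff n (r i) ≠ PowerSeries.coeff n (r j) := by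
        by_contra hall
        push Not at hall
        exact hne (PowerSeries.ext hall)
      exact ⟨n, fun _ ↦ hn⟩
  choose nsep hnsep using hsep0
  set N₀ : ℕ := Finset.univ.sup nsep with hN₀
  have hsep : ∀ i j, i ≠ j → nsep (i, j) ≤ N₀ ∧
      PowerSeries.coeff (nsep (i, j)) (r i) ≠ PowerSeries.coeff (nsep (i, j)) (r j) :=
    fun i j hij ↦ ⟨Finset.le_sup (Finset.mem_univ (i, j)), hnsep (i, j) hij⟩
  -- ### the formal polynomial
  set L : PowerSeries ℂ := 𝓣[b d] with hL
  set QT : Polynomial (PowerSeries ℂ) := Polynomial.C L * ∏ i, (Polynomial.X - Polynomial.C (r i))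
    with hQT
  have hL0 : L ≠ 0 := by
    intro h
    have := congrArg PowerSeries.constantCoeff h
    rw [hL, constantCoeff_taylor, map_zero] at this
    exact hb0 this
  have hQTdeg : QT.natDegree ≤ d := by
    rw [hQT]
    refine (Polynomial.natDegree_C_mul_le _ _).trans ?_
    rw [Polynomial.natDegree_finsetProd_X_sub_C_eq_card, Finset.card_univ, hd]
  have hQT0 : QT ≠ 0 :=
    mul_ne_zero (by rwa [Ne, Polynomial.C_eq_zero]) (Polynomial.monic_prod_X_sub_C _ _).ne_zero
  have hQTroot : ∀ i, QT.eval (r i) = 0 := fun i ↦ by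
    rw [hQT, Polynomial.eval_mul, Polynomial.eval_prod,
      Finset.prod_eq_zero (Finset.mem_univ i) (by simp), mul_zero]
  have hQTcoef : ∀ n ∈ range (d + 1), QT.coeff n = 𝓣[b n] := fun n hn ↦ (hfact n hn).symm
  have hQTsimple : ∀ i, (Polynomial.derivative QT).eval (r i) ≠ 0 :=
    (roots_eq_and_derivative_eval_ne_zero hQT0 hr (hd ▸ hQTdeg) hQTroot).2
  -- ### holomorphic roots with prescribed jets
  have hF3 : ∀ i, ∃ K ≥ N₀ + 1, ∃ ε > 0, ε ≤ ρ ∧ ∃ y : ℂ → ℂ, DifferentiableOn ℂ y (ball 0 ε) ∧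
      (∀ z ∈ ball (0 : ℂ) ε, ∑ n ∈ range (d + 1), b n z * y z ^ n = 0) ∧
      ∀ n < K, PowerSeries.coeff n 𝓣[y] = PowerSeries.coeff n (r i) := fun i ↦
    exists_holomorphic_root_of_formal_root hρ hb QT hQTdeg hQTcoef (hQTroot i) (hQTsimple i)
      (N₀ + 1)
  choose K hK ε hε hερ y hyd hyroot hyjet using hF3
  set ε₀ : ℝ := Finset.univ.inf' Finset.univ_nonempty ε with hε₀
  have hε₀pos : 0 < ε₀ := by
    rw [hε₀, Finset.lt_inf'_iff]
    exact fun i _ ↦ hε i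
  have hε₀le : ∀ i, ε₀ ≤ ε i := fun i ↦ Finset.inf'_le _ (Finset.mem_univ i)
  have hε₀ρ : ε₀ ≤ ρ := (hε₀le (Classical.arbitrary ι)).trans (hερ _)
  have hyd₀ : ∀ i, DifferentiableOn ℂ (y i) (ball 0 ε₀) := fun i ↦
    (hyd i).mono (ball_subset_ball (hε₀le i))
  have hyA : ∀ i, AnalyticAt ℂ (y i) 0 := fun i ↦ analyticAt_of_differentiableOn_ball hε₀pos (hyd₀ i)
  have hbA : ∀ n ∈ range (d + 1), AnalyticAt ℂ (b n) 0 := fun n hn ↦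
    analyticAt_of_differentiableOn_ball hρ (hb n hn)
  -- ### the full Taylor series of the roots
  have hTy : ∀ i, 𝓣[y i] = r i := by
    intro i
    have hyn : ∀ n : ℕ, AnalyticAt ℂ (y i ^ n) 0 := fun n ↦ (hyA i).pow n
    have han : ∀ n ∈ range (d + 1), AnalyticAt ℂ (b n * y i ^ n) 0 := fun n hn ↦ (hbA n hn).mul (hyn n)
    have hzero : 𝓣[∑ n ∈ range (d + 1), (b n * y i ^ n)] = 0 := by
      rw [taylor_eq_zero_iff (Finset.analyticAt_sum _ han)]
      filter_upwards [ball_mem_nhds (0 : ℂ) (hε i)] with t ht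
      simp only [Finset.sum_apply, Pi.mul_apply, Pi.pow_apply, Pi.zero_apply]
      exact hyroot i t ht
    have heval : 𝓣[∑ n ∈ range (d + 1), (b n * y i ^ n)] = QT.eval 𝓣[y i] := by
      rw [taylor_sum _ han, Polynomial.eval_eq_sum_range' (n := d + 1) (by omega)]
      refine Finset.sum_congr rfl fun n hn ↦ ?_
      rw [taylor_mul (hbA n hn) (hyn n), taylor_pow (hyA i), hQTcoef n hn]
    have hroot : QT.eval 𝓣[y i] = 0 := by rw [← heval, hzero]
    rw [hQT, Polynomial.eval_mul, Polynomial.eval_prod, mul_eq_zero] at hroot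
    rcases hroot with hL' | hprod
    · rw [Polynomial.eval_C] at hL'
      exact absurd hL' hL0
    · rw [Finset.prod_eq_zero_iff] at hprod
      obtain ⟨j, -, hj⟩ := hprod
      rw [Polynomial.eval_sub, Polynomial.eval_X, Polynomial.eval_C, sub_eq_zero] at hj
      by_cases hij : i = j
      · subst hij; exact hj
      · exfalso
        obtain ⟨hle, hne⟩ := hsep i j hij
        have h1 := hyjet i (nsep (i, j)) (by have := hK i; omega)
        rw [hj] at h1
        exact hne h1.symm
  -- ### distinct germs: distinct values on a punctured neighbourhood
  have hgerm : ∀ i j, i ≠ j → ∀ᶠ t in 𝓝[≠] (0 : ℂ), y i t ≠ y j t := by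
    intro i j hij
    rcases ((hyA i).sub (hyA j)).eventually_eq_zero_or_eventually_ne_zero with h0 | h0
    · exfalso
      have heq : 𝓣[y i] = 𝓣[y j] := by
        apply taylor_congr
        filter_upwards [h0] with t ht
        simpa [sub_eq_zero] using ht
      rw [hTy i, hTy j] at heq
      exact hij (hr heq)
    · filter_upwards [h0] with t ht
      simpa [sub_eq_zero] using ht
  have hgermall : ∀ᶠ t in 𝓝[≠] (0 : ℂ), ∀ p : ι × ι, p.1 ≠ p.2 → y p.1 t ≠ y p.2 t := by
    rw [Filter.eventually_all]
    rintro ⟨i, j⟩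
    by_cases hij : i = j
    · exact Filter.Eventually.of_forall fun t h ↦ absurd hij h
    · filter_upwards [hgerm i j hij] with t ht using fun _ ↦ ht
  -- ### the factorization on a punctured neighbourhood
  have hbc : ContinuousAt (b d) 0 :=
    ((hb d hdmem).differentiableAt (ball_mem_nhds 0 hρ)).continuousAt
  have hc' : ∀ᶠ t in 𝓝 (0 : ℂ), b d t ≠ 0 := hbc.eventually_ne hb0
  have hball₀ : ∀ᶠ t in 𝓝 (0 : ℂ), t ∈ ball (0 : ℂ) ε₀ := ball_mem_nhds 0 hε₀pos
  set poly : ℂ → ℂ[X] := fun t ↦ ∑ n ∈ range (d + 1), Polynomial.C (b n t) * Polynomial.X ^ n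
    with hpoly
  have hpolycoeff : ∀ t n, (poly t).coeff n = if n ∈ range (d + 1) then b n t else 0 := by
    intro t n
    simp only [hpoly, Polynomial.finsetSum_coeff, Polynomial.coeff_C_mul_X_pow]
    rw [Finset.sum_ite_eq]
  have hpolydeg : ∀ t, (poly t).natDegree ≤ d := fun t ↦ by
    refine (Polynomial.natDegree_sum_le _ _).trans (Finset.sup_le fun n hn ↦ ?_)
    exact (Polynomial.natDegree_C_mul_X_pow_le _ _).trans (Nat.lt_succ_iff.mp (mem_range.mp hn))
  have hpolyeval : ∀ t w, (poly t).eval w = ∑ n ∈ range (d + 1), b n t * w ^ n := fun t w ↦ by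
    simp only [hpoly, Polynomial.eval_finsetSum, Polynomial.eval_mul, Polynomial.eval_C,
      Polynomial.eval_pow, Polynomial.eval_X]
  have hpunct : ∀ᶠ t in 𝓝[≠] (0 : ℂ),
      poly t = Polynomial.C (b d t) * ∏ i, (Polynomial.X - Polynomial.C (y i t)) := by
    filter_upwards [hgermall, eventually_nhdsWithin_of_eventually_nhds hc',
      eventually_nhdsWithin_of_eventually_nhds hball₀] with t hdist hct hbt
    have hqd : (poly t).coeff d = b d t := by rw [hpolycoeff, if_pos hdmem]
    have hqdeg' : (poly t).natDegree = d :=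
      Polynomial.natDegree_eq_of_le_of_coeff_ne_zero (hpolydeg t) (by rwa [hqd])
    have hq0 : poly t ≠ 0 := fun h ↦ hct (by rw [← hqd, h, Polynomial.coeff_zero])
    have hinj : Function.Injective fun i ↦ y i t := fun i j h ↦ by
      by_contra hij
      exact hdist (i, j) hij h
    have hroots : ∀ i, (poly t).eval (y i t) = 0 := fun i ↦ by
      rw [hpolyeval]
      exact hyroot i t (ball_subset_ball (hε₀le i) hbt)
    obtain ⟨hrts, -⟩ := roots_eq_and_derivative_eval_ne_zero hq0 hinj (by rw [hqdeg', hd]) hroots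
    have hcardroots : Multiset.card (poly t).roots = (poly t).natDegree := by
      rw [hrts, Finset.map_val, Multiset.card_map, Finset.card_val, Finset.card_univ, hqdeg', hd]
    have h := Polynomial.C_leadingCoeff_mul_prod_multiset_X_sub_C hcardroots
    rw [Polynomial.leadingCoeff, hqdeg', hqd, hrts, Finset.map_val, Multiset.map_map] at h
    rw [← h]
    congr 1
  -- ### extension to `t = 0` by continuity of the coefficients
  have hcoefev : ∀ m, ∀ᶠ t in 𝓝 (0 : ℂ), (poly t).coeff m =
      (Polynomial.C (b d t) * ∏ i, (Polynomial.X - Polynomial.C (y i t))).coeff m := by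
    intro m
    set fm : ℂ → ℂ := fun t ↦ (poly t).coeff m -
      (Polynomial.C (b d t) * ∏ i, (Polynomial.X - Polynomial.C (y i t))).coeff m with hfm
    have hfmc : ContinuousAt fm 0 := by
      have h1 : DifferentiableOn ℂ (fun t : ℂ ↦ (poly t).coeff m) (ball 0 ε₀) := by
        have : (fun t : ℂ ↦ (poly t).coeff m) = fun t ↦ if m ∈ range (d + 1) then b m t else 0 := by
          funext t; rw [hpolycoeff]
        rw [this]
        split_ifs with hm
        · exact (hb m hm).mono (ball_subset_ball hε₀ρ)
        · exact differentiableOn_const _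
      have h2 : DifferentiableOn ℂ (fun t : ℂ ↦ (Polynomial.C (b d t) *
          ∏ i, (Polynomial.X - Polynomial.C (y i t))).coeff m) (ball 0 ε₀) :=
        differentiableOn_coeff_C_mul_prod ((hb d hdmem).mono (ball_subset_ball hε₀ρ)) Finset.univ
          (fun i _ ↦ hyd₀ i) m
      exact ((h1.sub h2).differentiableAt (ball_mem_nhds 0 hε₀pos)).continuousAt
    have hfm0 : fm 0 = 0 := by
      have hpw : fm =ᶠ[𝓝[≠] (0 : ℂ)] fun _ ↦ 0 := by
        filter_upwards [hpunct] with t ht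
        simp only [hfm, ht, sub_self]
      have h1 : Tendsto fm (𝓝[≠] (0 : ℂ)) (𝓝 (fm 0)) := hfmc.tendsto.mono_left nhdsWithin_le_nhds
      have h2 : Tendsto fm (𝓝[≠] (0 : ℂ)) (𝓝 0) := tendsto_const_nhds.congr' hpw.symm
      exact tendsto_nhds_unique h1 h2
    have hall : ∀ᶠ t in 𝓝 (0 : ℂ), t ≠ 0 → fm t = 0 := by
      have := hpunct
      rw [eventually_nhdsWithin_iff] at this
      filter_upwards [this] with t ht h0
      simp only [hfm, ht h0, sub_self]
    filter_upwards [hall] with t ht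
    by_cases h0 : t = 0
    · subst h0; exact sub_eq_zero.mp hfm0
    · exact sub_eq_zero.mp (ht h0)
  have hfinal : ∀ᶠ t in 𝓝 (0 : ℂ),
      poly t = Polynomial.C (b d t) * ∏ i, (Polynomial.X - Polynomial.C (y i t)) := by
    have hlow : ∀ᶠ t in 𝓝 (0 : ℂ), ∀ m ∈ range (d + 1),
        (poly t).coeff m = (Polynomial.C (b d t) *
          ∏ i, (Polynomial.X - Polynomial.C (y i t))).coeff m :=
      (Filter.eventually_all_finset _).mpr fun m _ ↦ hcoefev m
    filter_upwards [hlow] with t ht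
    apply Polynomial.ext
    intro m
    by_cases hm : m ∈ range (d + 1)
    · exact ht m hm
    · have hm' : d < m := by rw [Finset.mem_range] at hm; omega
      rw [Polynomial.coeff_eq_zero_of_natDegree_lt ((hpolydeg t).trans_lt hm'),
        Polynomial.coeff_eq_zero_of_natDegree_lt]
      calc (Polynomial.C (b d t) * ∏ i, (Polynomial.X - Polynomial.C (y i t))).natDegree
          ≤ (∏ i, (Polynomial.X - Polynomial.C (y i t)) : ℂ[X]).natDegree :=
            Polynomial.natDegree_C_mul_le _ _
        _ = d := by rw [Polynomial.natDegree_finsetProd_X_sub_C_eq_card, Finset.card_univ, hd]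
        _ < m := hm'
  obtain ⟨ε₁, hε₁, hε₁ball⟩ := Metric.eventually_nhds_iff_ball.mp hfinal
  exact ⟨min ε₀ ε₁, lt_min hε₀pos hε₁, (min_le_left _ _).trans hε₀ρ, y,
    fun i ↦ (hyd₀ i).mono (ball_subset_ball (min_le_left _ _)), hTy,
    fun t ht ↦ hε₁ball t (ball_subset_ball (min_le_right _ _) ht)⟩

end FormalRoot

end Literature.Analysis.Complex
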